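import Summits.ResolutionOfSingularities.ResolutionOfSingularities.Theorems.WildConesClassicalRegimesDefs

/-!
# Route `WildCones`, crux `ClassicalRegimes` (stmt-ResolutionOfSingularities-16884),
# line `milnor-descent`, stub `stub_highOrdNotIsol`: cleaned order `≥ p + 2` has no isolated
# successor

For the point-blow-up dynamics of `z^p = a(u₁,…,uₙ)` named in
`Theorems/WildConesClassicalRegimesDefs.lean` (`clean`, `bl`, `dv`, `tr`, `step`, `ser`, `pd`,
`jac`, `Isol`, `MultP`, `OrdP`, `OrdPSucc`) we prove: if the cleaned state `clean c` is non-zero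
of order `≥ p` (`MultP c`) and has no monomial of degree `p` (`¬ OrdP c`) nor of degree `p + 1`
(`¬ OrdPSucc c`) — i.e. its order is `≥ p + 2` — then for every number `n ≥ 2` of variables, every
chart `i` and every translation `τ` the successor `step p n κ i τ c` is NOT isolated:
`κ[[u]] ⧸ (∂₁a', …, ∂ₙa')` is not finite over `κ`.

Argument (elementary support bookkeeping).  Every monomial `u^A` of `clean c` has `|A| ≥ p + 2`.
The total transform in chart `u_i` followed by division by `u_i^s` (`s = p` or `0`, always `≤ p`)
sends it to a monomial with `u_i`-exponent `|A| - s ≥ 2`; the translation `u_j ↦ u_j + τ_j`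
(`j ≠ i`) never changes the `u_i`-exponent, and cleaning only deletes monomials.  Hence `u_i²`
divides the successor's series, so `u_i` divides each formal partial `∂_l`, the Jacobian ideal lies
in `(u_i)`, and modulo an ideal contained in `(u_i)` the powers `u_j^k` (`j ≠ i`, which exists as
`n ≥ 2`) are `κ`-linearly independent — impossible in a finite (Noetherian) `κ`-module.
The mechanics of the last step follow `Theorems/ClosingReduction/Negative/LoadBearing.lean`
(`curveBlowUp_witness_not_isolated`).  Mathlib only; the hypotheses `p.Prime`, `CharP`,
`PerfectField` of the registered signature are not used.
-/

noncomputable section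

set_option linter.dupNamespace false

open scoped BigOperators Classical

namespace Summit.ResolutionOfSingularities.ResolutionOfSingularities.Theorems.WildCones

/-! ## Stub `stub_highOrdNotIsol`: cleaned order `≥ p + 2` has no isolated successor -/

namespace HighOrdNotIsol

variable {p n : ℕ} {κ : Type} [Field κ]

/-- A non-zero cleaned coefficient is a non-zero original coefficient. [folklore] -/
theorem ne_zero_of_clean_ne_zero {c : (Fin n → ℕ) → κ} {A : Fin n → ℕ}
    (h : clean p n κ c A ≠ 0) : c A ≠ 0 := by
  unfold clean at h
  by_cases hA : ∀ j, p ∣ A j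
  · rw [if_pos hA] at h
    exact absurd rfl h
  · rwa [if_neg hA] at h

/-- Summing an updated exponent over the other indices ignores the update. [folklore] -/
theorem sum_erase_update (B : Fin n → ℕ) (i : Fin n) (v : ℕ) :
    Finset.sum (Finset.univ.erase i) (fun j => Function.update B i v j) =
      Finset.sum (Finset.univ.erase i) (fun j => B j) :=
  Finset.sum_congr rfl fun j hj => by rw [Function.update_of_ne (Finset.ne_of_mem_erase hj)]

/-- Total degree of an updated exponent: `Σ (update B i v) = v + Σ_{j ≠ i} B j`. [folklore] -/
theorem sum_update (B : Fin n → ℕ) (i : Fin n) (v : ℕ) :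
    Finset.sum Finset.univ (fun j => Function.update B i v j) =
      v + Finset.sum (Finset.univ.erase i) (fun j => B j) := by
  rw [← Finset.add_sum_erase _ _ (Finset.mem_univ i), Function.update_self, sum_erase_update]

/-- Support of the divided total transform (chart `u_i`, division by `u_i^s`): a non-zero
coefficient at `B` is a coefficient of `a` at an exponent of total degree `B i + s`. [folklore] -/
theorem exists_of_dv_bl_ne_zero {a : (Fin n → ℕ) → κ} {i : Fin n} {s : ℕ} {B : Fin n → ℕ}
    (h : dv n κ i s (bl n κ i a) B ≠ 0) :
    ∃ A, a A ≠ 0 ∧ Finset.sum Finset.univ (fun j => A j) = B i + s := by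
  simp only [dv, bl, Function.update_self, Function.update_idem, sum_erase_update] at h
  by_cases hle : Finset.sum (Finset.univ.erase i) (fun j => B j) ≤ B i + s
  · rw [if_pos hle] at h
    refine ⟨_, h, ?_⟩
    rw [sum_update]
    omega
  · exact absurd (if_neg hle) h

/-- Support of the translate: a non-zero coefficient at `B` needs a non-zero coefficient of the
translated function at some `B + D` with `D i = 0` (translation fixes the `u_i`-exponent).
[folklore] -/
theorem exists_of_tr_ne_zero {g : (Fin n → ℕ) → κ} {i : Fin n} {τ : Fin n → κ} {s : ℕ}
    {B : Fin n → ℕ} (h : tr n κ i τ s g B ≠ 0) : ∃ D : Fin n → ℕ, D i = 0 ∧ g (B + D) ≠ 0 := by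
  simp only [tr] at h
  obtain ⟨D, -, hD⟩ := Finset.exists_ne_zero_of_sum_ne_zero h
  by_cases hDi : D i = 0
  · rw [if_pos hDi] at hD
    exact ⟨D, hDi, left_ne_zero_of_mul hD⟩
  · exact absurd (if_neg hDi) hD

/-- **Support of the successor, general division exponent `s ≤ p`.** If every monomial of the
cleaned state has degree `≥ p + 2`, every monomial of
`clean (tr i τ s (dv i s (bl i (clean c))))` has `u_i`-exponent `≥ 2`. [folklore] -/
theorem two_le_of_ne_zero {c : (Fin n → ℕ) → κ} {i : Fin n} {τ : Fin n → κ} {s : ℕ}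
    (hsp : s ≤ p)
    (hc : ∀ A, clean p n κ c A ≠ 0 → p + 2 ≤ Finset.sum Finset.univ (fun j => A j))
    {B : Fin n → ℕ}
    (h : clean p n κ (tr n κ i τ s (dv n κ i s (bl n κ i (clean p n κ c)))) B ≠ 0) :
    2 ≤ B i := by
  obtain ⟨D, hDi, hD⟩ := exists_of_tr_ne_zero (ne_zero_of_clean_ne_zero h)
  obtain ⟨A, hA, hsum⟩ := exists_of_dv_bl_ne_zero hD
  have hpA := hc A hA
  simp only [Pi.add_apply, hDi, add_zero] at hsum
  omega

/-- **Support of the successor.** If every monomial of the cleaned state has degree `≥ p + 2`, then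
every monomial of `step p n κ i τ c` has `u_i`-exponent `≥ 2` (the division exponent is `p` or `0`,
in either case `≤ p`). [folklore] -/
theorem two_le_of_step_ne_zero {c : (Fin n → ℕ) → κ} {i : Fin n} {τ : Fin n → κ}
    (hc : ∀ A, clean p n κ c A ≠ 0 → p + 2 ≤ Finset.sum Finset.univ (fun j => A j))
    {B : Fin n → ℕ} (h : step p n κ i τ c B ≠ 0) : 2 ≤ B i :=
  two_le_of_ne_zero (s := @ite ℕ (p ≤ ord n κ (clean p n κ c)) (Classical.dec _) p 0)
    (by split_ifs <;> omega) hc h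

/-- If every monomial of `c'` has `u_i`-exponent `≥ 2`, then `u_i` divides every formal partial
derivative `∂_l` of the cleaned series of `c'`. [folklore] -/
theorem X_dvd_pd_ser {c' : (Fin n → ℕ) → κ} {i : Fin n} (hc' : ∀ B, c' B ≠ 0 → 2 ≤ B i)
    (l : Fin n) : (MvPowerSeries.X i : MvPowerSeries (Fin n) κ) ∣ pd n κ l (ser p n κ c') := by
  rw [MvPowerSeries.X_dvd_iff]
  intro m hm
  show ((m l + 1 : ℕ) : κ) * clean p n κ c' ⇑(m + Finsupp.single l (1 : ℕ)) = 0
  by_contra hne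
  have h2 := hc' _ (ne_zero_of_clean_ne_zero (right_ne_zero_of_mul hne))
  simp only [Finsupp.coe_add, Pi.add_apply, hm, zero_add] at h2
  have h1 : (Finsupp.single l 1 : Fin n →₀ ℕ) i ≤ 1 := by
    rw [Finsupp.single_apply]
    split_ifs <;> omega
  omega

/-- Hence the Jacobian ideal of such a `c'` lies in the principal ideal `(u_i)`. [folklore] -/
theorem jac_le_span_X {c' : (Fin n → ℕ) → κ} {i : Fin n} (hc' : ∀ B, c' B ≠ 0 → 2 ≤ B i) :
    jac p n κ c' ≤ Ideal.span {(MvPowerSeries.X i : MvPowerSeries (Fin n) κ)} := by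
  unfold jac
  rw [Ideal.span_le, Set.range_subset_iff]
  intro l
  exact Ideal.mem_span_singleton.2 (X_dvd_pd_ser hc' l)

/-- **Template "ideal `≤ (u_i)` in `n ≥ 2` variables ⇒ quotient not finite over `κ`":** the classes
of the powers `u_j ^ k` of another variable `u_j` (`j ≠ i`) are `κ`-linearly independent modulo any
ideal `J ≤ (u_i)` (a member of `(u_i)` has no pure-`u_j` monomial), and a linearly independent
family in a finite (hence Noetherian) module is finite. [folklore] -/
theorem not_finite_of_le_span_X (hn : 2 ≤ n) {J : Ideal (MvPowerSeries (Fin n) κ)} {i : Fin n}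
    (hJ : J ≤ Ideal.span {(MvPowerSeries.X i : MvPowerSeries (Fin n) κ)}) :
    ¬ Module.Finite κ (MvPowerSeries (Fin n) κ ⧸ J) := by
  intro hfin
  haveI : Nontrivial (Fin n) := Fin.nontrivial_iff_two_le.mpr hn
  obtain ⟨j, hj⟩ := exists_ne i
  have hli : LinearIndependent κ
      (fun k : ℕ => Ideal.Quotient.mk J ((MvPowerSeries.X j : MvPowerSeries (Fin n) κ) ^ k)) := by
    rw [linearIndependent_iff']
    intro s a hs k hk
    have hsum : Ideal.Quotient.mk J
        (s.sum fun m => a m • (MvPowerSeries.X j : MvPowerSeries (Fin n) κ) ^ m) = 0 := by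
      rw [map_sum, ← hs]
      exact Finset.sum_congr rfl fun _ _ => rfl
    rw [Ideal.Quotient.eq_zero_iff_mem] at hsum
    have hdvd : (MvPowerSeries.X i : MvPowerSeries (Fin n) κ) ∣
        s.sum fun m => a m • (MvPowerSeries.X j : MvPowerSeries (Fin n) κ) ^ m :=
      Ideal.mem_span_singleton.1 (hJ hsum)
    rw [MvPowerSeries.X_dvd_iff] at hdvd
    have hk0 := hdvd (Finsupp.single j k) (by rw [Finsupp.single_apply, if_neg hj])
    rw [map_sum, Finset.sum_eq_single k] at hk0
    · simpa [MvPowerSeries.coeff_X_pow] using hk0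
    · intro m _ hmk
      rw [map_smul, MvPowerSeries.coeff_X_pow, if_neg, smul_zero]
      intro h
      apply hmk
      have := congrArg (fun f => f j) h
      simpa using this.symm
    · intro hks
      exact (hks hk).elim
  have : Finite ℕ := hli.finite_of_isNoetherian
  exact not_finite ℕ

end HighOrdNotIsol

open HighOrdNotIsol in
/-- **Stub `stub_highOrdNotIsol` (line `milnor-descent`).** A multiplicity-`p` state of cleaned
order `≥ p + 2` (`MultP c ∧ ¬ OrdP c ∧ ¬ OrdPSucc c`) has NO isolated successor, in any number
`n ≥ 2` of variables, any chart `i`, any translation `τ`: every monomial of the successor has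
`u_i`-exponent `≥ 2` (blow-up + division by `u_i^p` turns degree `d ≥ p + 2` into `u_i`-exponent
`d - p ≥ 2`; translation along `u_i = 0` and cleaning do not lower it), so `u_i` divides every
`∂_l` of the successor, its Jacobian ideal lies in `(u_i)`, and `κ[[u]] ⧸ (∂a')` carries the
linearly independent family `u_j ^ k` (`j ≠ i`), hence is not finite over `κ`. [folklore] -/
theorem stub_highOrdNotIsol : ∀ p : ℕ, p.Prime → ∀ n : ℕ, 2 ≤ n → ∀ (κ : Type) [Field κ] [CharP κ p]
    [PerfectField κ] (c : (Fin n → ℕ) → κ) (i : Fin n) (τ : Fin n → κ),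
    MultP p n κ c → ¬ OrdP p n κ c → ¬ OrdPSucc p n κ c → ¬ Isol p n κ (step p n κ i τ c) := by
  intro p _ n hn κ _ _ _ c i τ hM hO hOS
  have hc : ∀ A, clean p n κ c A ≠ 0 → p + 2 ≤ Finset.sum Finset.univ (fun j => A j) := by
    intro A hA
    have h1 := hM.2 A hA
    have h2 : Finset.sum Finset.univ (fun j => A j) ≠ p := fun h => hO ⟨A, hA, h⟩
    have h3 : Finset.sum Finset.univ (fun j => A j) ≠ p + 1 := fun h => hOS ⟨A, hA, h⟩
    omega
  have hc' : ∀ B, step p n κ i τ c B ≠ 0 → 2 ≤ B i := fun B hB => two_le_of_step_ne_zero hc hB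
  exact not_finite_of_le_span_X hn (jac_le_span_X hc')

end Summit.ResolutionOfSingularities.ResolutionOfSingularities.Theorems.WildCones

end
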